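import Mathlib
import Summits.Ventures.PercRepro2.Defs
import Summits.Ventures.PercRepro2.Graph
import Summits.Ventures.PercRepro2.OneColourSwitch
import Summits.Ventures.PercRepro2.RegionHubSign
import Summits.Ventures.PercRepro2.SideSwitch
import Summits.Ventures.PercRepro2.SideSwitchFibre
import Summits.Ventures.PercRepro2.SideSwitchComps
import Summits.Ventures.PercRepro2.M9NoPocketDefs
import Summits.Ventures.PercRepro2.M9NoPocketWorld
import Summits.Ventures.PercRepro2.M9NoPocketWorldD
import Summits.Ventures.PercRepro2.M9NoPocketCompl
import Summits.Ventures.PercRepro2.M9NoPocketCompl2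
import Summits.Ventures.PercRepro2.M9NoPocketFlipRS
import Summits.Ventures.PercRepro2.M9PsiOneDefs
import Summits.Ventures.PercRepro2.M9NoPocketFreeBlock
import Summits.Ventures.PercRepro2.M9NoPocketFreeBlockK
import Summits.Ventures.PercRepro2.M9NoPocketSameType
import Summits.Ventures.PercRepro2.M9NoPocketDeadPattern
import Summits.Ventures.PercRepro2.M9NoPocketLinkCompl
import Summits.Ventures.PercRepro2.M9NoPocketLinkE

/-!
# The sign `σ_rs` of the points of a unit (blind cell PercRepro2, p3 g36, 2026-08-29;
`proofs/P3-NPHDR.md` §5(a)–(c), in the uniform form of the unit assembly)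

For a same-type representative `ρ` let `𝔑` be its joined blocks, `𝔉` its free blocks, `𝔉L ⊆ 𝔉`
the free blocks linking `r` and `s` internally, `λ S := [r ~_Y s at the point with the joined
`W`-side set `S` and every free block switched]` and `ℓK D := [r ~_Y s at the `K`-point of the
dead pattern `D` with every free block switched]`.  Then, for `T ⊆ 𝔉` and `S ⊆ 𝔑`,
**the sign of a type-`E` point** is
`σ_rs(T ∪ S) = [T ∩ 𝔉L = ∅]·(1 − λ (𝔑 ∖ S)) − [𝔉L ⊆ T]·(1 − λ S)` (`sigma_rs_E_eq`: the
`Y`-link of `conn_rs_E_iff`, the `W`-link through the colour flip `conn_compl_assignX_iff`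
and the same lemma at the dual point), and **the sign of a `K`-point** of a dead pattern is
`σ_rs(κ_D(T)) = [T ∩ 𝔉L = ∅] − [𝔉L ⊆ T]·(1 − ℓK D)` (`sigma_rs_K_eq`: the `Y`-link of
`conn_rs_K_iff`, the `W`-link through the colour flip and the free-only link
`conn_rs_iff_exists_linksIn` at the dual `M`-point).  Both formulas cover the case `𝔉L = ∅`
(then both indicators are `1`) and the mixed case (both `0`).  Own work; std axioms.
-/

namespace Summit.Ventures.PercRepro2

namespace NoPocket

open Finset Classical RegionHub OneColourSwitch SideSwitch

variable {V : Type*} {E : Type*}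

section Sets

variable [Fintype V] [DecidableEq V] [Fintype E] [DecidableEq E] {ends : E → Sym2 V}

omit [Fintype E] [DecidableEq E] in
/-- The free and the joined blocks partition the blocks. -/
lemma free_union_joined {d r s : V} (ρ : Config E) :
    (blocks ends d r s ρ).filter (fun C => ¬ hasY ends d ρ C) ∪
      (blocks ends d r s ρ).filter (hasY ends d ρ) = blocks ends d r s ρ := by
  rw [Finset.union_comm]
  exact Finset.filter_union_filter_not_eq _ _

omit [Fintype E] [DecidableEq E] in
/-- The complement of `T ∪ S` in the blocks, for `T` free and `S` joined. -/
lemma blocks_sdiff_union {d r s : V} (ρ : Config E) {T S : Finset (Finset V)}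
    (hT : T ⊆ (blocks ends d r s ρ).filter (fun C => ¬ hasY ends d ρ C))
    (hS : S ⊆ (blocks ends d r s ρ).filter (hasY ends d ρ)) :
    blocks ends d r s ρ \ (T ∪ S) =
      ((blocks ends d r s ρ).filter (fun C => ¬ hasY ends d ρ C) \ T) ∪
        ((blocks ends d r s ρ).filter (hasY ends d ρ) \ S) := by
  ext C
  simp only [Finset.mem_sdiff, Finset.mem_union, Finset.mem_filter, not_or]
  constructor
  · rintro ⟨hC, hCT, hCS⟩
    by_cases hY : hasY ends d ρ C
    · exact Or.inr ⟨⟨hC, hY⟩, hCS⟩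
    · exact Or.inl ⟨⟨hC, hY⟩, hCT⟩
  · rintro (⟨⟨hC, hY⟩, hCT⟩ | ⟨⟨hC, hY⟩, hCS⟩)
    · exact ⟨hC, hCT, fun h => hY (Finset.mem_filter.1 (hS h)).2⟩
    · exact ⟨hC, fun h => (Finset.mem_filter.1 (hT h)).2 hY, hCS⟩

omit [Fintype E] [DecidableEq E] in
/-- A set of free blocks lies in `T ∪ S` (`S` joined) exactly when it lies in `T`. -/
lemma subset_union_joined_iff {d r s : V} (ρ : Config E) {L T S : Finset (Finset V)}
    (hL : L ⊆ (blocks ends d r s ρ).filter (fun C => ¬ hasY ends d ρ C))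
    (hS : S ⊆ (blocks ends d r s ρ).filter (hasY ends d ρ)) :
    L ⊆ T ∪ S ↔ L ⊆ T := by
  constructor
  · intro h C hC
    rcases Finset.mem_union.1 (h hC) with h' | h'
    · exact h'
    · exact absurd (Finset.mem_filter.1 (hS h')).2 (Finset.mem_filter.1 (hL hC)).2
  · intro h C hC
    exact Finset.mem_union_left _ (h hC)

omit [Fintype E] [DecidableEq E] in
/-- A set of free blocks lies in the complement `(𝔉 ∖ T) ∪ (𝔑 ∖ S)` exactly when it misses
`T`. -/
lemma subset_sdiff_union_iff {d r s : V} (ρ : Config E) {L T S : Finset (Finset V)}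
    (hL : L ⊆ (blocks ends d r s ρ).filter (fun C => ¬ hasY ends d ρ C)) :
    L ⊆ ((blocks ends d r s ρ).filter (fun C => ¬ hasY ends d ρ C) \ T) ∪
        ((blocks ends d r s ρ).filter (hasY ends d ρ) \ S) ↔ T ∩ L = ∅ := by
  constructor
  · intro h
    rw [Finset.eq_empty_iff_forall_notMem]
    intro C hC
    obtain ⟨hCT, hCL⟩ := Finset.mem_inter.1 hC
    rcases Finset.mem_union.1 (h hCL) with h' | h'
    · exact (Finset.mem_sdiff.1 h').2 hCT
    · exact (Finset.mem_filter.1 (hL hCL)).2 (Finset.mem_filter.1 (Finset.mem_sdiff.1 h').1).2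
  · intro h C hC
    refine Finset.mem_union_left _ (Finset.mem_sdiff.2 ⟨hL hC, fun hCT => ?_⟩)
    have : C ∈ T ∩ L := Finset.mem_inter.2 ⟨hCT, hC⟩
    rw [h] at this
    exact Finset.notMem_empty C this

omit [Fintype E] [DecidableEq E] in
/-- Adding every free block to `T ∪ S` (`T` free) gives `𝔉 ∪ S`. -/
lemma union_union_free {d r s : V} (ρ : Config E) {T S : Finset (Finset V)}
    (hT : T ⊆ (blocks ends d r s ρ).filter (fun C => ¬ hasY ends d ρ C)) :
    T ∪ S ∪ (blocks ends d r s ρ).filter (fun C => ¬ hasY ends d ρ C) =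
      (blocks ends d r s ρ).filter (fun C => ¬ hasY ends d ρ C) ∪ S := by
  ext C
  simp only [Finset.mem_union]
  constructor
  · rintro ((h | h) | h)
    · exact Or.inl (hT h)
    · exact Or.inr h
    · exact Or.inl h
  · rintro (h | h)
    · exact Or.inr h
    · exact Or.inl (Or.inr h)

omit [Fintype E] [DecidableEq E] in
/-- Adding every free block to `(𝔉 ∖ T) ∪ S'` gives `𝔉 ∪ S'`. -/
lemma sdiff_union_union_free {d r s : V} (ρ : Config E) (T S' : Finset (Finset V)) :
    ((blocks ends d r s ρ).filter (fun C => ¬ hasY ends d ρ C) \ T) ∪ S' ∪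
        (blocks ends d r s ρ).filter (fun C => ¬ hasY ends d ρ C) =
      (blocks ends d r s ρ).filter (fun C => ¬ hasY ends d ρ C) ∪ S' := by
  ext C
  simp only [Finset.mem_union, Finset.mem_sdiff]
  constructor
  · rintro ((⟨h, _⟩ | h) | h)
    · exact Or.inl h
    · exact Or.inr h
    · exact Or.inl h
  · rintro (h | h)
    · exact Or.inr h
    · exact Or.inl (Or.inr h)

end Sets

section SigmaRS

variable [Fintype V] [DecidableEq V] [Fintype E] [DecidableEq E] {ends : E → Sym2 V}

/-- A subset of the free blocks is a legal vector of every dead pattern. -/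
lemma mem_L4_flipF_of_free {d r s : V} {ρ₀ : Config E}
    (hst : ∀ e, d ∈ ends e → ρ₀ e = true) {D : Finset E} (hD : ∀ e ∈ D, d ∈ ends e)
    {T : Finset (Finset V)}
    (hTf : T ⊆ (blocks ends d r s ρ₀).filter (fun C => ¬ hasY ends d ρ₀ C)) :
    ((T, ∅) : Finset (Finset V) × Finset E) ∈ L4 ends d r s (flipF D ρ₀) := by
  have hb := blocks_flipF (ends := ends) (r := r) (s := s) (ρ := ρ₀) hD
  have hfree : ∀ C ∈ T, Free ends d C := fun C hC =>
    (free_iff_not_hasY_sameType hst C).2 (Finset.mem_filter.1 (hTf hC)).2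
  rw [mem_L4]
  refine ⟨⟨by rw [hb]; exact hTf.trans (Finset.filter_subset _ _), Finset.empty_subset _⟩,
    ?_, ?_⟩
  · intro hsrcW
    exfalso
    rcases hsrcW with ⟨e, he, _⟩ | ⟨C, hCx, hY⟩
    · exact Finset.notMem_empty e he
    · exact not_hasY_flipF_of_free hst D (hfree C hCx) hY
  · intro _ C hCx
    exact not_hasW_flipF_of_free hst D (hfree C hCx)

/-- **The sign `σ_rs` of a type-`E` point** of a same-type representative. -/
theorem sigma_rs_E_eq {p q r s d : V} (hnp : NoPocketAt ends d r s) (hr : d ≠ r) (hs : d ≠ s)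
    (hT : Tset ends d r s = ∅) (hrs : ∀ e, ends e ≠ s(r, s)) {ρ : Config E}
    (hρ : ρ ∈ RepD ends p q r s d) (hst : ∀ e, d ∈ ends e → ρ e = true)
    {T S : Finset (Finset V)}
    (hTf : T ⊆ (blocks ends d r s ρ).filter (fun C => ¬ hasY ends d ρ C))
    (hS : S ⊆ (blocks ends d r s ρ).filter (hasY ends d ρ)) :
    sigma ends (assignX ends (T ∪ S, ∅) ρ) r s =
      (if T ∩ ((blocks ends d r s ρ).filter (fun C => ¬ hasY ends d ρ C)).filter
          (LinksIn ends ρ r s) = ∅ then 1 else 0) *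
        (1 - (if Conn ends (assignX ends ((blocks ends d r s ρ).filter
            (fun C => ¬ hasY ends d ρ C) ∪ ((blocks ends d r s ρ).filter (hasY ends d ρ) \ S),
            ∅) ρ) r s then 1 else 0)) -
      (if ((blocks ends d r s ρ).filter (fun C => ¬ hasY ends d ρ C)).filter
          (LinksIn ends ρ r s) ⊆ T then 1 else 0) *
        (1 - (if Conn ends (assignX ends ((blocks ends d r s ρ).filter
            (fun C => ¬ hasY ends d ρ C) ∪ S, ∅) ρ) r s then 1 else 0)) := by
  have hLf : ((blocks ends d r s ρ).filter (fun C => ¬ hasY ends d ρ C)).filter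
      (LinksIn ends ρ r s) ⊆ (blocks ends d r s ρ).filter (fun C => ¬ hasY ends d ρ C) :=
    Finset.filter_subset _ _
  have hTb : T ⊆ blocks ends d r s ρ := hTf.trans (Finset.filter_subset _ _)
  have hSb : S ⊆ blocks ends d r s ρ := hS.trans (Finset.filter_subset _ _)
  have hX : T ∪ S ⊆ blocks ends d r s ρ := Finset.union_subset hTb hSb
  -- the `Y`-link
  have hY := conn_rs_E_iff hnp hr hs hρ hst hX
  rw [subset_union_joined_iff ρ hLf hS, union_union_free ρ hTf] at hY
  -- the `W`-link: the colour flip is the dual point, whose `Y`-link is blind to the outside flip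
  have hW : Conn ends (OneColourSwitch.compl (assignX ends (T ∪ S, ∅) ρ)) r s ↔
      ¬ (T ∩ ((blocks ends d r s ρ).filter (fun C => ¬ hasY ends d ρ C)).filter
          (LinksIn ends ρ r s) = ∅) ∨
        Conn ends (assignX ends ((blocks ends d r s ρ).filter (fun C => ¬ hasY ends d ρ C) ∪
          ((blocks ends d r s ρ).filter (hasY ends d ρ) \ S), ∅) ρ) r s := by
    rw [conn_compl_assignX_iff hnp hr hs hT hrs hρ hX r s]
    have hX' : blocks ends d r s ρ \ (T ∪ S) ⊆ blocks ends d r s ρ := Finset.sdiff_subset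
    rw [conn_rs_assignX_flipOp_iff hnp hr hs hρ ((mem_L4_sameType_iff hT hst).2 ⟨hX', rfl⟩)]
    rw [blocks_sdiff_union ρ hTf hS]
    have hX'' : ((blocks ends d r s ρ).filter (fun C => ¬ hasY ends d ρ C) \ T) ∪
        ((blocks ends d r s ρ).filter (hasY ends d ρ) \ S) ⊆ blocks ends d r s ρ :=
      Finset.union_subset (Finset.sdiff_subset.trans (Finset.filter_subset _ _))
        (Finset.sdiff_subset.trans (Finset.filter_subset _ _))
    rw [conn_rs_E_iff hnp hr hs hρ hst hX'', subset_sdiff_union_iff ρ hLf,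
      sdiff_union_union_free ρ T _]
  unfold sigma
  by_cases h1 : ((blocks ends d r s ρ).filter (fun C => ¬ hasY ends d ρ C)).filter
      (LinksIn ends ρ r s) ⊆ T <;>
    by_cases h2 : T ∩ ((blocks ends d r s ρ).filter (fun C => ¬ hasY ends d ρ C)).filter
      (LinksIn ends ρ r s) = ∅ <;>
    by_cases h3 : Conn ends (assignX ends ((blocks ends d r s ρ).filter
      (fun C => ¬ hasY ends d ρ C) ∪ S, ∅) ρ) r s <;>
    by_cases h4 : Conn ends (assignX ends ((blocks ends d r s ρ).filter
      (fun C => ¬ hasY ends d ρ C) ∪ ((blocks ends d r s ρ).filter (hasY ends d ρ) \ S),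
      ∅) ρ) r s <;>
    simp [hY, hW, h1, h2, h3, h4]

/-- **The sign `σ_rs` of a `K`-point** of a dead pattern of a same-type representative. -/
theorem sigma_rs_K_eq {p q r s d : V} (hnp : NoPocketAt ends d r s) (hr : d ≠ r) (hs : d ≠ s)
    (hT : Tset ends d r s = ∅) (hrs : ∀ e, ends e ≠ s(r, s)) (hrs' : r ≠ s) {ρ : Config E}
    (hρ : ρ ∈ RepD ends p q r s d) (hst : ∀ e, d ∈ ends e → ρ e = true) {D : Finset E}
    (hD : ∀ e ∈ D, d ∈ ends e) {T : Finset (Finset V)}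
    (hTf : T ⊆ (blocks ends d r s ρ).filter (fun C => ¬ hasY ends d ρ C)) :
    sigma ends (assignX ends (T, ∅) (flipF D ρ)) r s =
      (if T ∩ ((blocks ends d r s ρ).filter (fun C => ¬ hasY ends d ρ C)).filter
          (LinksIn ends ρ r s) = ∅ then 1 else 0) -
      (if ((blocks ends d r s ρ).filter (fun C => ¬ hasY ends d ρ C)).filter
          (LinksIn ends ρ r s) ⊆ T then 1 else 0) *
        (1 - (if Conn ends (assignX ends ((blocks ends d r s ρ).filter
            (fun C => ¬ hasY ends d ρ C), ∅) (flipF D ρ)) r s then 1 else 0)) := by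
  have hρD := flipF_mem_RepD hρ hT hD
  have hb := blocks_flipF (ends := ends) (r := r) (s := s) (ρ := ρ) hD
  have hTb : T ⊆ blocks ends d r s ρ := hTf.trans (Finset.filter_subset _ _)
  have hTb' : T ⊆ blocks ends d r s (flipF D ρ) := by rw [hb]; exact hTb
  -- the `Y`-link
  have hY := conn_rs_K_iff hnp hr hs hT hρ hst hD hTf
  -- the `W`-link: the dual `M`-point of the outside-flipped dead pattern, free-only link
  have hW : Conn ends (OneColourSwitch.compl (assignX ends (T, ∅) (flipF D ρ))) r s ↔
      ¬ (T ∩ ((blocks ends d r s ρ).filter (fun C => ¬ hasY ends d ρ C)).filter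
          (LinksIn ends ρ r s) = ∅) := by
    rw [conn_compl_assignX_iff hnp hr hs hT hrs hρD hTb' r s]
    have hρ' := flipOp_mem_RepD hr hs hρD
    have hb' : blocks ends d r s (flipOp ends d r s (flipF D ρ)) = blocks ends d r s ρ := by
      rw [blocks_flipOp hr hs, hb]
    have hX' : blocks ends d r s (flipF D ρ) \ T ⊆
        blocks ends d r s (flipOp ends d r s (flipF D ρ)) := by
      rw [hb', hb]; exact Finset.sdiff_subset
    have hfree' : ∀ C ∈ blocks ends d r s (flipOp ends d r s (flipF D ρ)),
        C ∉ blocks ends d r s (flipF D ρ) \ T → Free ends d C := by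
      intro C hC hCX
      rw [hb'] at hC
      rw [hb] at hCX
      have hCT : C ∈ T := by
        by_contra h
        exact hCX (Finset.mem_sdiff.2 ⟨hC, h⟩)
      exact (free_iff_not_hasY_sameType hst C).2 (Finset.mem_filter.1 (hTf hCT)).2
    have hsrc : ¬ srcY ends d r s (flipOp ends d r s (flipF D ρ))
        (blocks ends d r s (flipF D ρ) \ T, ∅) := by
      rintro (⟨e, he, _⟩ | ⟨C, hC, hCX, hY'⟩)
      · rw [hT] at he
        exact Finset.notMem_empty e he
      · have hCD : C ∈ blocks ends d r s (flipF D ρ) := by rw [hb]; rw [hb'] at hC; exact hC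
        rw [hasY_flipOp hCD] at hY'
        exact not_hasY_flipF_of_free hst D (hfree' C hC hCX) hY'
    rw [conn_rs_iff_exists_linksIn hnp hr hs hrs hrs' hρ' hX' hfree' hsrc]
    constructor
    · rintro ⟨C, hC, hCX, hl⟩ h0
      rw [hb'] at hC
      rw [hb] at hCX
      have hCT : C ∈ T := by
        by_contra h
        exact hCX (Finset.mem_sdiff.2 ⟨hC, h⟩)
      have hl' : LinksIn ends ρ r s C := by
        rw [linksIn_flipOp_iff (by rw [hb]; exact hC), linksIn_flipF_iff hr hs hD hC] at hl
        exact hl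
      have : C ∈ T ∩ ((blocks ends d r s ρ).filter (fun C => ¬ hasY ends d ρ C)).filter
          (LinksIn ends ρ r s) := Finset.mem_inter.2 ⟨hCT, Finset.mem_filter.2 ⟨hTf hCT, hl'⟩⟩
      rw [h0] at this
      exact Finset.notMem_empty C this
    · intro h0
      obtain ⟨C, hC⟩ := Finset.nonempty_iff_ne_empty.2 h0
      obtain ⟨hCT, hCL⟩ := Finset.mem_inter.1 hC
      have hCb : C ∈ blocks ends d r s ρ := (Finset.mem_filter.1 (Finset.mem_filter.1 hCL).1).1
      have hCD : C ∈ blocks ends d r s (flipF D ρ) := by rw [hb]; exact hCb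
      refine ⟨C, by rw [hb']; exact hCb, fun h => (Finset.mem_sdiff.1 h).2 hCT, ?_⟩
      rw [linksIn_flipOp_iff hCD, linksIn_flipF_iff hr hs hD hCb]
      exact (Finset.mem_filter.1 hCL).2
  unfold sigma
  by_cases h1 : ((blocks ends d r s ρ).filter (fun C => ¬ hasY ends d ρ C)).filter
      (LinksIn ends ρ r s) ⊆ T <;>
    by_cases h2 : T ∩ ((blocks ends d r s ρ).filter (fun C => ¬ hasY ends d ρ C)).filter
      (LinksIn ends ρ r s) = ∅ <;>
    by_cases h3 : Conn ends (assignX ends ((blocks ends d r s ρ).filter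
      (fun C => ¬ hasY ends d ρ C), ∅) (flipF D ρ)) r s <;>
    simp [hY, hW, h1, h2, h3]

end SigmaRS

end NoPocket

end Summit.Ventures.PercRepro2
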